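import Summits.QuantumFields.QCD.Theses.TransparentRPWall
import Summits.QuantumFields.YangMills.Theorems.PencilRigidityDiagonalMirrorRPRStubRpClosureSupport
import Summits.QuantumFields.YangMills.Theorems.PencilRigidityDiagonalMirrorRPRStubRpClosureDensity
import HarnessLib

/-!
# `DiagonalRPClosure` (stmt-QuantumFields-17996, route TransparentRPWall, support) — proved

Piece X_C of the BC2 redirect of `TransparentRPWall.WallDiagonalRP`: MODEL-BLIND DIAGONAL RP CLOSURE, any label type.  For a
labelled Schwinger family `S` on `ℝ⁴` with E0 and ANY approximants `Λ_k` that (0) equal `1` in degree `0`, (1) converge to `S` on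
compactly supported real tensors with pairwise disjoint supports and (2) are EVENTUALLY swap-Gram positive on compactly supported real
families in `{x₁ < x₀}`, and with `S` invariant on `⁰𝒮` under the proper signed permutations: the pull-back of `S` by EVERY diagonal
frame `R e₀ = a e₀ + b e₁`, `a² = b² = ½`, is reflection positive.  This file follows the registered skeleton
`Cruxes/WallDiagonalRP/Lines/DiagonalRPClosure_birth.lean` (crux-strategist, 2026-08-17) but is DEFINITION-FREE (the skeleton's
abbreviations `swapTest`/`gram`/`ApproxData`/`ProductPSD` are inlined):
* §1 frame bookkeeping in a canonical frame `R e₀ = c(e₀ − e₁)` — rotated slab factors are compactly supported in `{y¹ < y⁰}`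
  (`frame_time`), `(swap)(f ∘ R⁻¹) = (Θf) ∘ R⁻¹` (`linActTest_thetaTest_apply`), rotated ordered slabs stay disjoint;
* §2 `productPSD_of_approx` — THE LIMIT STEP (= registered stub `stub_productPSD`): the swap Gram forms of `Λ_k` on the rotated
  factors are `Λ_k` of the rotated factor strings of `ΘP_i* ⊗ P_j`, converge entrywise (clause (1), `append_slabs`; degree `0` by E0 and
  clause (0)) and are eventually in the closed set `{0 ≤ re, im = 0}` (clause (2));
* §3 `rp_of_productPSD` — THE DENSITY STEP (= registered stub `stub_rpOfProductPSD`): Gram positivity on slab-ordered compact real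
  product families ⇒ E2, by joint continuity of the finite-list OS form, sesquilinear expansion, and the landed ordered-wedge density
  with compact supports (`RpClosure.mem_closure_span_slabOrderedCompactProducts`) — the closure argument of the landed one-species
  `RpClosure.isReflectionPositive_pullback` with label strings carried;
* §4 `diagonalRPClosure_proof` — every diagonal frame by the landed frame normal form (`RpClosure.frame_normal_form`) and transport along
  the proper-hypercubic invariance (`CurvatureChannel.linActMulti_trans`, `isOffDiagonal_linActMulti_of_isAppendTensorOf`) —
  the skeleton's PROVED composition.
Width seat ym-line-sfw-p2-w2 g24 (cell ym-idea-1; free hands).  The two registered stubs are also filed by name in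
`…DiagonalRPClosureProductPSD.lean` / `…DiagonalRPClosureRpOfProductPSD.lean` (review-queued: they carry the skeleton's abbrevs).
HONEST FRAMING: support item X_C only; the crux `WallDiagonalRP` (needs `CoverWallRP` + `WallTransparency`) remains OPEN; no rung or summit
is proved; nothing here bears on the Yang–Mills mass gap. [cite: OsterwalderSchrader1973, §2] [cite: GlimmJaffeQP1987, §6.1]
-/

set_option autoImplicit false

noncomputable section

namespace Summit.QuantumFields.QCD.Theorems.TransparentRPWallDiagonalRPClosureProof

open scoped BigOperators Topology ComplexConjugate SchwartzMap
open Filter Set Function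
open Literature.MathematicalPhysics.QuantumLattice Literature.MathematicalPhysics.AQFT
open Summit.QuantumFields.YangMills.Cruxes.DiagonalMirrorRPR.ParityBridgeColdTraces.RpClosure
  (ee swap01 frame_time linActTest_thetaTest_apply append_slabs isTensorOf_osAdjoint_appendTensor
    hasCompactSupport_linActTest hasCompactSupport_thetaTest slabOrderedCompactProducts frame_normal_form
    mem_closure_span_slabOrderedCompactProducts)

/-! ## §1 Frame bookkeeping -/

/-- `(h ∘ swap) v = h (swap v)`. [folklore] -/
theorem swapTest_apply (h : 𝓢(EuclideanSpace ℝ (Fin 4), ℝ)) (v : EuclideanSpace ℝ (Fin 4)) :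
    SchwartzMap.compCLMOfContinuousLinearEquiv ℝ (LinearIsometryEquiv.piLpCongrLeft 2 ℝ ℝ (Equiv.swap (0 : Fin 4) 1)).toContinuousLinearEquiv h v =
      h (swap01 v) := by
  show h _ = h (swap01 v)
  congr 1

variable {R : EuclideanSpace ℝ (Fin 4) ≃ₗᵢ[ℝ] EuclideanSpace ℝ (Fin 4)} {c : ℝ}

/-- In a canonical frame the reflected-then-rotated factor is the rotated-then-swapped factor:
`swapTest (f ∘ R⁻¹) = (Θ f) ∘ R⁻¹`. [folklore] -/
theorem swapTest_linActTest (hR : R (ee 0) = c • ee 0 + (-c) • ee 1) (hc : c ^ 2 = 1 / 2)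
    (f : 𝓢(EuclideanSpace ℝ (Fin 4), ℝ)) :
    SchwartzMap.compCLMOfContinuousLinearEquiv ℝ (LinearIsometryEquiv.piLpCongrLeft 2 ℝ ℝ (Equiv.swap (0 : Fin 4) 1)).toContinuousLinearEquiv (linActTest R f) =
      linActTest R (thetaTest 4 f) := by
  ext v
  rw [swapTest_apply, linActTest_thetaTest_apply hR hc]

/-- A factor supported in `{lo ≤ x⁰}` with `lo > 0` becomes, after the frame rotation, supported in `{y¹ < y⁰}`. [folklore] -/
theorem tsupport_linActTest_subset (hR : R (ee 0) = c • ee 0 + (-c) • ee 1) (hc0 : 0 < c) {f : 𝓢(EuclideanSpace ℝ (Fin 4), ℝ)}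
    {lo hi : ℝ} (hlo : 0 < lo) (hf : tsupport (f : EuclideanSpace ℝ (Fin 4) → ℝ) ⊆ {x | lo ≤ x 0 ∧ x 0 ≤ hi}) :
    tsupport (linActTest R f : EuclideanSpace ℝ (Fin 4) → ℝ) ⊆ {y : EuclideanSpace ℝ (Fin 4) | y 1 < y 0} := by
  intro y hy
  have h1 : (linActTest R f : EuclideanSpace ℝ (Fin 4) → ℝ) = fun y => f (R.symm y) := funext fun y => linActTest_apply R f y
  rw [h1] at hy
  have h2 := hf (tsupport_schwartz_comp_subset f R.symm.continuous hy)
  simp only [Set.mem_setOf_eq, frame_time hR] at h2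
  simp only [Set.mem_setOf_eq]
  nlinarith [h2.1]

/-- Rotated factors with disjoint time slabs have disjoint supports. [folklore] -/
theorem disjoint_tsupport_linActTest {k : ℕ} {g : Fin k → 𝓢(EuclideanSpace ℝ (Fin 4), ℝ)} {lo hi : Fin k → ℝ}
    (hord : ∀ p q, p < q → hi p < lo q) (hsupp : ∀ p, tsupport (g p : EuclideanSpace ℝ (Fin 4) → ℝ) ⊆ {x | lo p ≤ x 0 ∧ x 0 ≤ hi p})
    (p q : Fin k) (hpq : p ≠ q) :
    Disjoint (tsupport (linActTest R (g p) : EuclideanSpace ℝ (Fin 4) → ℝ))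
      (tsupport (linActTest R (g q) : EuclideanSpace ℝ (Fin 4) → ℝ)) := by
  have h1 : ∀ s, (linActTest R (g s) : EuclideanSpace ℝ (Fin 4) → ℝ) = fun y => g s (R.symm y) := fun s => funext fun y => linActTest_apply R _ y
  refine Set.disjoint_left.2 fun y hyp hyq => ?_
  rw [h1] at hyp hyq
  have hp := hsupp p (tsupport_schwartz_comp_subset (g p) R.symm.continuous hyp)
  have hq := hsupp q (tsupport_schwartz_comp_subset (g q) R.symm.continuous hyq)
  simp only [Set.mem_setOf_eq] at hp hq
  rcases lt_or_gt_of_ne hpq with h | h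
  · have := hord p q h; linarith [hp.2, hq.1]
  · have := hord q p h; linarith [hp.1, hq.2]

/-! ## §2 The limit step (registered stub `stub_productPSD`, inlined statement) -/

/-- **THE LIMIT STEP**: approximant data force Gram positivity of the pulled-back family on slab-ordered compact real products in
every canonical diagonal frame. [cite: OsterwalderSchrader1973, §2] -/
theorem productPSD_of_approx {ι : Type} (S : LabelledSchwingerFamily ι (EuclideanSpace ℝ (Fin 4)))
    (Λ : ℕ → (n : ℕ) → (Fin n → ι) → (Fin n → 𝓢(EuclideanSpace ℝ (Fin 4), ℝ)) → ℂ) (hE0 : S.IsNormalized)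
    (hΛ0 : ∀ (k : ℕ) (σ : Fin 0 → ι) (f : Fin 0 → 𝓢(EuclideanSpace ℝ (Fin 4), ℝ)), Λ k 0 σ f = 1)
    (hconv : ∀ (n : ℕ), n ≠ 0 → ∀ (σ : Fin n → ι) (f : Fin n → 𝓢(EuclideanSpace ℝ (Fin 4), ℝ)),
      (∀ i, HasCompactSupport (f i : EuclideanSpace ℝ (Fin 4) → ℝ)) →
        (∀ i j, i ≠ j → Disjoint (tsupport (f i : EuclideanSpace ℝ (Fin 4) → ℝ)) (tsupport (f j : EuclideanSpace ℝ (Fin 4) → ℝ))) →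
          ∀ F : 𝓢((Fin n → EuclideanSpace ℝ (Fin 4)), ℂ), IsTensorOf F (fun i => ofRealTest (f i)) →
            Tendsto (fun k : ℕ => Λ k n σ f) atTop (𝓝 (S n σ F)))
    (hrp : ∀ (N : ℕ) (c : Fin N → ℂ) (deg : Fin N → ℕ) (lab : (j : Fin N) → Fin (deg j) → ι)
      (f : (j : Fin N) → Fin (deg j) → 𝓢(EuclideanSpace ℝ (Fin 4), ℝ)),
      (∀ j l, HasCompactSupport (f j l : EuclideanSpace ℝ (Fin 4) → ℝ) ∧
        tsupport (f j l : EuclideanSpace ℝ (Fin 4) → ℝ) ⊆ {y : EuclideanSpace ℝ (Fin 4) | y 1 < y 0}) →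
        ∀ᶠ k in atTop,
          let z := ∑ i, ∑ j, starRingEnd ℂ (c i) * c j *
            Λ k (deg i + deg j) (Fin.append (lab i ∘ Fin.rev) (lab j))
              (Fin.append (fun l => SchwartzMap.compCLMOfContinuousLinearEquiv ℝ (LinearIsometryEquiv.piLpCongrLeft 2 ℝ ℝ (Equiv.swap (0 : Fin 4) 1)).toContinuousLinearEquiv (f i (Fin.rev l))) (f j));
          0 ≤ z.re ∧ z.im = 0)
    {R : EuclideanSpace ℝ (Fin 4) ≃ₗᵢ[ℝ] EuclideanSpace ℝ (Fin 4)} {c : ℝ} (hc : c ^ 2 = 1 / 2) (hc0 : 0 < c)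
    (hR : R (EuclideanSpace.single 0 1) = c • EuclideanSpace.single 0 1 + (-c) • EuclideanSpace.single 1 1) :
    ∀ (N : ℕ) (coef : Fin N → ℂ) (deg : Fin N → ℕ) (lab : (j : Fin N) → Fin (deg j) → ι)
      (P : (j : Fin N) → 𝓢((Fin (deg j) → EuclideanSpace ℝ (Fin 4)), ℂ)), (∀ j, P j ∈ slabOrderedCompactProducts 4 (deg j)) →
        ∀ H : (i j : Fin N) → 𝓢((Fin (deg i + deg j) → EuclideanSpace ℝ (Fin 4)), ℂ),
          (∀ i j, IsAppendTensorOf (H i j) (osAdjoint (P i)) (P j)) →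
            let z := ∑ i, ∑ j, starRingEnd ℂ (coef i) * coef j *
              ((S (deg i + deg j) (Fin.append (lab i ∘ Fin.rev) (lab j))).comp (linActMulti R)) (H i j)
            0 ≤ z.re ∧ z.im = 0 := by
  intro N coef deg lab P hP H hH z
  choose f lo hi hT hlo hle hord hsupp hcs using hP
  -- the frame-rotated factors and the rotated factor strings of `Θ P_i* ⊗ P_j`
  let fR : (j : Fin N) → Fin (deg j) → 𝓢(EuclideanSpace ℝ (Fin 4), ℝ) := fun j l => linActTest R (f j l)
  let g : (i j : Fin N) → Fin (deg i + deg j) → 𝓢(EuclideanSpace ℝ (Fin 4), ℝ) := fun i j =>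
    Fin.append (fun l => thetaTest 4 (f i (Fin.rev l))) (f j)
  let gR : (i j : Fin N) → Fin (deg i + deg j) → 𝓢(EuclideanSpace ℝ (Fin 4), ℝ) := fun i j p => linActTest R (g i j p)
  -- the closed target set
  let C : Set ℂ := {w | 0 ≤ w.re ∧ w.im = 0}
  have hCcl : IsClosed C :=
    (isClosed_le continuous_const Complex.continuous_re).inter (isClosed_eq Complex.continuous_im continuous_const)
  -- (a) the rotated factors are compactly supported in `{y¹ < y⁰}`, so the swap Gram forms are eventually positive
  have hfR : ∀ j l, HasCompactSupport (fR j l : EuclideanSpace ℝ (Fin 4) → ℝ) ∧ tsupport (fR j l : EuclideanSpace ℝ (Fin 4) → ℝ) ⊆ {y : EuclideanSpace ℝ (Fin 4) | y 1 < y 0} :=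
    fun j l => ⟨hasCompactSupport_linActTest (hcs j l) R, tsupport_linActTest_subset hR hc0 (hlo j l) (hsupp j l)⟩
  -- (b) the Gram entries are `Λ_k` of the rotated factor strings
  have hstring : ∀ i j, Fin.append (fun l => SchwartzMap.compCLMOfContinuousLinearEquiv ℝ (LinearIsometryEquiv.piLpCongrLeft 2 ℝ ℝ (Equiv.swap (0 : Fin 4) 1)).toContinuousLinearEquiv (fR i (Fin.rev l))) (fR j) = gR i j := by
    intro i j
    funext p
    induction p using Fin.addCases with
    | left l => simp only [Fin.append_left, gR, g, fR, swapTest_linActTest hR hc]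
    | right l => simp only [Fin.append_right, gR, g, fR]
  have hev : ∀ᶠ k in atTop, (∑ i, ∑ j, conj (coef i) * coef j *
      Λ k (deg i + deg j) (Fin.append (lab i ∘ Fin.rev) (lab j)) (gR i j)) ∈ C := by
    refine (hrp N coef deg lab fR hfR).mono fun k hk => ?_
    simp only [hstring] at hk
    exact hk
  -- (c) entry convergence
  have hHeq : ∀ i j, H i j = (osAdjoint (P i)).appendTensor (P j) := fun i j => by
    ext x
    rw [hH i j x, SchwartzMap.appendTensor_apply]
  have hentry : ∀ i j, Tendsto (fun k => Λ k (deg i + deg j) (Fin.append (lab i ∘ Fin.rev) (lab j)) (gR i j)) atTop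
      (𝓝 (S (deg i + deg j) (Fin.append (lab i ∘ Fin.rev) (lab j)) (linActMulti R (H i j)))) := by
    intro i j
    have hTg : IsTensorOf ((osAdjoint (P i)).appendTensor (P j)) fun p => ofRealTest (g i j p) :=
      isTensorOf_osAdjoint_appendTensor (hT i) (hT j)
    have hTgR : IsTensorOf (linActMulti R ((osAdjoint (P i)).appendTensor (P j))) fun p => ofRealTest (gR i j p) :=
      hTg.linActMulti R
    rw [hHeq i j]
    by_cases hn : deg i + deg j = 0
    · -- degree zero: both sides are `1`
      have hΛ : ∀ {m : ℕ} (_ : m = 0) (σ : Fin m → ι) (φ : Fin m → 𝓢(EuclideanSpace ℝ (Fin 4), ℝ)) (k : ℕ), Λ k m σ φ = 1 := by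
        intro m hm σ φ k
        subst hm
        exact hΛ0 k σ φ
      have hS : ∀ {m : ℕ} (_ : m = 0) (σ : Fin m → ι) (F : 𝓢((Fin m → EuclideanSpace ℝ (Fin 4)), ℂ)) (x : Fin m → EuclideanSpace ℝ (Fin 4)), S m σ F = F x := by
        intro m hm σ F x
        subst hm
        exact (hE0 σ F).trans (congrArg F (Subsingleton.elim _ _))
      haveI : IsEmpty (Fin (deg i + deg j)) := by rw [hn]; infer_instance
      have hlim : S (deg i + deg j) (Fin.append (lab i ∘ Fin.rev) (lab j)) (linActMulti R ((osAdjoint (P i)).appendTensor (P j))) =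
          1 := by
        rw [hS hn _ _ (fun _ => 0), hTgR]
        simp
      simp only [hΛ hn, hlim]
      exact tendsto_const_nhds
    · obtain ⟨LO, HI, -, hord', hsupp'⟩ :=
        append_slabs (hlo i) (hle i) (hord i) (hsupp i) (hlo j) (hle j) (hord j) (hsupp j)
      exact hconv (deg i + deg j) hn _ (gR i j)
        (fun p => hasCompactSupport_linActTest (by
          induction p using Fin.addCases with
          | left l => simp only [g, Fin.append_left]; exact hasCompactSupport_thetaTest (hcs i _)
          | right l => simp only [g, Fin.append_right]; exact hcs j l) R)
        (fun p q hpq => disjoint_tsupport_linActTest hord' hsupp' p q hpq) _ hTgR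
  -- (d) assembling
  have hlim : Tendsto (fun k => ∑ i, ∑ j, conj (coef i) * coef j *
      Λ k (deg i + deg j) (Fin.append (lab i ∘ Fin.rev) (lab j)) (gR i j)) atTop
      (𝓝 (∑ i, ∑ j, conj (coef i) * coef j *
        S (deg i + deg j) (Fin.append (lab i ∘ Fin.rev) (lab j)) (linActMulti R (H i j)))) :=
    tendsto_finsetSum _ fun i _ => tendsto_finsetSum _ fun j _ => (hentry i j).const_mul _
  have hz : z = ∑ i, ∑ j, conj (coef i) * coef j *
      S (deg i + deg j) (Fin.append (lab i ∘ Fin.rev) (lab j)) (linActMulti R (H i j)) := by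
    simp only [z, ContinuousLinearMap.comp_apply]
  rw [hz]
  exact hCcl.mem_of_tendsto hlim hev


/-! ## §3 The density step (registered stub `stub_rpOfProductPSD`, inlined statement) -/

/-- Sesquilinear expansion of `T(Θ(Σ aᵢFᵢ)* ⊗ (Σ bⱼGⱼ))`. [folklore] -/
theorem pairing_sum_smul {n m : ℕ} (T : 𝓢((Fin (n + m) → EuclideanSpace ℝ (Fin 4)), ℂ) →L[ℂ] ℂ) {α κ : Type*} (s : Finset α) (t : Finset κ)
    (a : α → ℂ) (b : κ → ℂ) (F : α → 𝓢((Fin n → EuclideanSpace ℝ (Fin 4)), ℂ)) (G : κ → 𝓢((Fin m → EuclideanSpace ℝ (Fin 4)), ℂ)) :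
    T ((osAdjoint (∑ i ∈ s, a i • F i)).appendTensor (∑ j ∈ t, b j • G j)) =
      ∑ i ∈ s, ∑ j ∈ t, conj (a i) * b j * T ((osAdjoint (F i)).appendTensor (G j)) := by
  simp only [osAdjoint_sum, osAdjoint_smul, SchwartzMap.appendTensor_sum_left, SchwartzMap.appendTensor_sum_right,
    SchwartzMap.appendTensor_smul_left, SchwartzMap.appendTensor_smul_right, map_sum T, T.map_smul, smul_eq_mul,
    Finset.smul_sum]
  rw [Finset.sum_comm]
  refine Finset.sum_congr rfl fun i _ => Finset.sum_congr rfl fun j _ => ?_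
  ring

/-- **THE DENSITY STEP, any labelled family**: Gram positivity on slab-ordered compact real product families implies E2.
[cite: OsterwalderSchrader1973, §2] -/
theorem rp_of_productPSD {ι : Type} (S' : LabelledSchwingerFamily ι (EuclideanSpace ℝ (Fin 4)))
    (hP : ∀ (N : ℕ) (coef : Fin N → ℂ) (deg : Fin N → ℕ) (lab : (j : Fin N) → Fin (deg j) → ι)
      (P : (j : Fin N) → 𝓢((Fin (deg j) → EuclideanSpace ℝ (Fin 4)), ℂ)), (∀ j, P j ∈ slabOrderedCompactProducts 4 (deg j)) →
        ∀ H : (i j : Fin N) → 𝓢((Fin (deg i + deg j) → EuclideanSpace ℝ (Fin 4)), ℂ),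
          (∀ i j, IsAppendTensorOf (H i j) (osAdjoint (P i)) (P j)) →
            let z := ∑ i, ∑ j, starRingEnd ℂ (coef i) * coef j * S' (deg i + deg j) (Fin.append (lab i ∘ Fin.rev) (lab j)) (H i j)
            0 ≤ z.re ∧ z.im = 0) :
    S'.IsReflectionPositive := by
  intro N deg lab F hF H hH z
  -- the finite-list OS form on `∏ⱼ 𝓢((ℝ⁴)^{deg j})`
  let Φ : ((j : Fin N) → 𝓢((Fin (deg j) → EuclideanSpace ℝ (Fin 4)), ℂ)) → ℂ := fun G =>
    ∑ i, ∑ j, S' (deg i + deg j) (Fin.append (lab i ∘ Fin.rev) (lab j)) ((osAdjoint (G i)).appendTensor (G j))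
  have hΦ : Continuous Φ := by
    refine continuous_finsetSum _ fun i _ => continuous_finsetSum _ fun j _ => ?_
    exact continuous_iff_continuousAt.2 fun G =>
      ((S' (deg i + deg j) (Fin.append (lab i ∘ Fin.rev) (lab j))).continuous.tendsto _).comp
        (SchwartzMap.tendsto_appendTensor ((continuous_osAdjoint.tendsto (G i)).comp ((continuous_apply i).tendsto G))
          ((continuous_apply j).tendsto G))
  let C : Set ℂ := {w | 0 ≤ w.re ∧ w.im = 0}
  have hC : IsClosed C :=
    (isClosed_le continuous_const Complex.continuous_re).inter (isClosed_eq Complex.continuous_im continuous_const)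
  let A : Set ((j : Fin N) → 𝓢((Fin (deg j) → EuclideanSpace ℝ (Fin 4)), ℂ)) :=
    Set.pi Set.univ fun j => (Submodule.span ℂ (slabOrderedCompactProducts 4 (deg j)) : Set _)
  have hA : A ⊆ Φ ⁻¹' C := by
    intro G hG
    have hrep : ∀ j : Fin N, ∃ (k : ℕ) (cf : Fin k → ℂ) (v : Fin k → slabOrderedCompactProducts 4 (deg j)),
        ∑ i, cf i • (v i : 𝓢((Fin (deg j) → EuclideanSpace ℝ (Fin 4)), ℂ)) = G j :=
      fun j => Submodule.mem_span_set'.1 (hG j (Set.mem_univ j))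
    choose k cf v hv using hrep
    -- re-index the finite family `(j, l)` by `Fin M`
    let e : Fin (Fintype.card (Σ j : Fin N, Fin (k j))) ≃ (Σ j : Fin N, Fin (k j)) := (Fintype.equivFin _).symm
    have key := hP (Fintype.card (Σ j : Fin N, Fin (k j))) (fun m => cf (e m).1 (e m).2) (fun m => deg (e m).1)
      (fun m => lab (e m).1) (fun m => (v (e m).1 (e m).2 : 𝓢((Fin (deg (e m).1) → EuclideanSpace ℝ (Fin 4)), ℂ))) (fun m => (v (e m).1 (e m).2).2)
      (fun m m' => (osAdjoint (v (e m).1 (e m).2 : 𝓢((Fin (deg (e m).1) → EuclideanSpace ℝ (Fin 4)), ℂ))).appendTensor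
        (v (e m').1 (e m').2 : 𝓢((Fin (deg (e m').1) → EuclideanSpace ℝ (Fin 4)), ℂ)))
      (fun m m' => isAppendTensorOf_appendTensor _ _)
    dsimp only at key
    have hΦG : Φ G = ∑ p : (Σ j : Fin N, Fin (k j)), ∑ q : (Σ j : Fin N, Fin (k j)),
        conj (cf p.1 p.2) * cf q.1 q.2 *
          S' (deg p.1 + deg q.1) (Fin.append (lab p.1 ∘ Fin.rev) (lab q.1))
            ((osAdjoint (v p.1 p.2 : 𝓢((Fin (deg p.1) → EuclideanSpace ℝ (Fin 4)), ℂ))).appendTensor (v q.1 q.2 : 𝓢((Fin (deg q.1) → EuclideanSpace ℝ (Fin 4)), ℂ))) := by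
      simp only [Φ, ← hv]
      simp only [Fintype.sum_sigma]
      refine Finset.sum_congr rfl fun a _ => ?_
      rw [Finset.sum_comm]
      refine Finset.sum_congr rfl fun b _ => ?_
      exact pairing_sum_smul (S' (deg a + deg b) (Fin.append (lab a ∘ Fin.rev) (lab b))) Finset.univ Finset.univ (cf a) (cf b)
        (fun i => (v a i : 𝓢((Fin (deg a) → EuclideanSpace ℝ (Fin 4)), ℂ))) (fun i => (v b i : 𝓢((Fin (deg b) → EuclideanSpace ℝ (Fin 4)), ℂ)))
    have hΦG' : Φ G = ∑ m, ∑ m', conj (cf (e m).1 (e m).2) * cf (e m').1 (e m').2 *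
        S' (deg (e m).1 + deg (e m').1) (Fin.append (lab (e m).1 ∘ Fin.rev) (lab (e m').1))
          ((osAdjoint (v (e m).1 (e m).2 : 𝓢((Fin (deg (e m).1) → EuclideanSpace ℝ (Fin 4)), ℂ))).appendTensor
            (v (e m').1 (e m').2 : 𝓢((Fin (deg (e m').1) → EuclideanSpace ℝ (Fin 4)), ℂ))) := by
      rw [hΦG, ← Equiv.sum_comp e]
      exact Finset.sum_congr rfl fun m _ => (Equiv.sum_comp e _).symm
    show Φ G ∈ C
    rw [hΦG']
    exact key
  have hcl : closure A ⊆ Φ ⁻¹' C := (hC.preimage hΦ).closure_subset_iff.2 hA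
  have hFmem : (fun j : Fin N => F j) ∈ closure A := by
    rw [closure_pi_set]
    exact fun j _ =>
      mem_closure_span_slabOrderedCompactProducts (hF j)
  have hres : Φ (fun j => F j) ∈ C := hcl hFmem
  have hHeq : ∀ i j, H i j = (osAdjoint (F i)).appendTensor (F j) := fun i j => by
    ext x
    rw [hH i j x, SchwartzMap.appendTensor_apply]
  have hz : z = Φ (fun j => F j) := by
    simp only [z, Φ, hHeq]
  rw [hz]
  exact hres


/-! ## §4 The route item -/

/-- **`TransparentRPWall.DiagonalRPClosure`** (stmt-QuantumFields-17996): canonical frames by §2–§3; every diagonal frame by the landed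
frame normal form and transport along the proper-hypercubic invariance of `S` on `⁰𝒮` (the skeleton's composition).
[cite: OsterwalderSchrader1973, §2] -/
theorem diagonalRPClosure_proof : Summit.QuantumFields.QCD.Theses.TransparentRPWall.DiagonalRPClosure := by
  intro ι S Λ hE0 hhyp h0 hconv hrp R a b ha hb hR
  -- (1) frame normal form (LANDED, YangMills sibling)
  obtain ⟨P, c, hc, hc0, hdet, hsp, hframe⟩ := frame_normal_form ha hb hR
  -- (2) the canonical frame `R.trans P`
  have hcan : LabelledSchwingerFamily.IsReflectionPositive
      (fun n (k : Fin n → ι) => (S n k).comp (linActMulti (R.trans P))) :=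
    rp_of_productPSD _ (productPSD_of_approx S Λ hE0 h0 hconv hrp hc hc0 hframe)
  -- (3) transport back to `R`
  intro N deg lab F hF H hH
  have h' := hcan N deg lab F hF H hH
  have hkey : ∀ i j, S (deg i + deg j) (Fin.append (lab i ∘ Fin.rev) (lab j)) (linActMulti (R.trans P) (H i j)) =
      S (deg i + deg j) (Fin.append (lab i ∘ Fin.rev) (lab j)) (linActMulti R (H i j)) := by
    intro i j
    rw [Summit.QuantumFields.YangMills.Theorems.CurvatureChannel.linActMulti_trans]
    exact hhyp _ _ P hdet hsp _
      (Summit.QuantumFields.YangMills.Theorems.CurvatureChannel.isOffDiagonal_linActMulti_of_isAppendTensorOf R (hF i) (hF j)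
        (hH i j))
  simp only [ContinuousLinearMap.comp_apply, hkey] at h'
  simpa only [ContinuousLinearMap.comp_apply] using h'

end Summit.QuantumFields.QCD.Theorems.TransparentRPWallDiagonalRPClosureProof

/-- **`TransparentRPWall.DiagonalRPClosure` holds** (stmt-QuantumFields-17996), route-level name. [cite: OsterwalderSchrader1973, §2] -/
theorem Summit.QuantumFields.QCD.Theorems.transparentRPWall_diagonalRPClosure_proof :
    Summit.QuantumFields.QCD.Theses.TransparentRPWall.DiagonalRPClosure :=
  Summit.QuantumFields.QCD.Theorems.TransparentRPWallDiagonalRPClosureProof.diagonalRPClosure_proof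

end
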